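import Literature.Probability.RandomPlanarGeometry.ImaginaryGeometryIto
import HarnessLib

/-!
# Miller–Sheffield, Imaginary geometry I, Theorem 2.4 (⇒) for SLE(κ, ρ): `𝔥_t(z)` is indistinguishable from a continuous local martingale

Final file of the proof. J. Miller, S. Sheffield, *Imaginary geometry I: interacting SLEs*, PTRF
**164** (2016), §2.3 **Theorem 2.4**: "Then `W_t` and the `V_t^{j,q}` can be coupled with a
standard Brownian motion to describe an SLE_κ(ρ) process (up to the continuation threshold) if
and only if `𝔥_t(z)` evolves as a continuous local martingale in `t` for each fixed `z ∈ ℍ`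
until the time `z` is absorbed by `K_t`"; proof of (⇒): "can be seen by applying Itô's formula
(away from times when `W_t` collides with a force point)".

## The named fact `MillerSheffield2016_thm24_forward` is mis-stated; the corrected statement

`ImaginaryGeometryHarmonic.lean` vendors the forward direction for the tree's one-force-point
SLE(κ, ρ) (`IsSLEKappaRhoPair`, [LSW] §8.3) as `MillerSheffield2016_thm24_forward`:
`IsLocalMartingale (stoppedProcess (imaginaryHarmonicProcess κ ρ O W z) τ_δ) 𝓕ᴮ P ∧ a.s.
continuity`. That statement cannot be what the source proves in the tree's vocabulary:

* `IsLocalMartingale = Locally (Martingale ·)` and Mathlib's `Martingale` contains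
  `StronglyAdapted`, a SURE measurability requirement (every sample, raw filtration `𝓕ᴮ`, which is
  not completed). Since `brownian 0 = 0` identically, `𝓕ᴮ_0` is trivial, so every stopping time of
  a localising sequence is either `≡ 0` or everywhere positive; the fact therefore forces
  `ω ↦ 𝔥_{t∧τₙ∧τ_δ}(ω)` to be `𝓕ᴮ_t`-measurable for EVERY `ω`.
* But an SLE(κ, ρ) pair `(O, W)` of the tree is built pathwise from an arbitrary Bessel process
  `X = √Z`, `Z` adapted with only a.s.-continuous paths: `O_t = -2 ∫₀ᵗ du/(√κ X_u)` is a parametric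
  Bochner integral of a sectionwise- but not jointly-measurable integrand and is not known to be
  `𝓕ᴮ_t`-measurable (`SLEKappaRhoRegular.lean`: "whose time integral `O` is not known to be
  adapted"), and neither is `W = √κ X + O`, nor the Loewner objects of the (possibly discontinuous)
  path `s ↦ W_s(ω)`. Every other SLE(κ, ρ) martingale statement of the tree is accordingly
  existential (`∃ M, SLEKappaRho.IsOneSidedMartingale …`).
* The source works under the usual conditions (Def. 2.1: "adapted to the filtration of `B_t`"),
  where indistinguishable processes are interchangeable; "evolves as a continuous local
  martingale" is a statement about the process up to indistinguishability.

The faithful transcription, vendored here as `MillerSheffield2016_thm24_forward_ae` with the same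
quantifiers and the same stopped process, is: **`𝔥^{τ_δ}` is INDISTINGUISHABLE from a continuous
local martingale** — there is a process `M`, a local martingale for `𝓕ᴮ` under the pre-Wiener
measure with a.s. continuous paths, such that a.s. `𝔥_{t∧τ_δ}(z) = M_t` for all `t`. It is PROVED
(`MillerSheffield2016_thm24_forward_ae_holds`); in fact `M = 𝔥_0(z) + (2λ/π) K` with `K` a
square-integrable martingale (the diffusion coefficient `-(2λ√κ/π)·y/|z|²` of `𝔥` is bounded by
`2λ√κ/(πδ)` before the approach time).

## The proof (files `ImaginaryGeometryPointFlow/Regular/Localized/Ito.lean` and this one)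

Regular version `(W', J)` of the pair with good paths a.s. (`W = √κB + ρ∫J`, `O = -2∫J`,
`J = 1/Z'`, collision set null); the point flow as progressive processes; localisation at the
optional times `ρₙ`; `x/y` and `(x + Z')/y` as Itô processes (progressive product rule); Itô's
formula for the two `arctan`s of the slope form of `𝔥`; the drift
`XY/Q²·((2λ/π)(4-κ) - 4χ) = 0`; hence `𝔥_{t∧ρₙ} = 𝔥_0 + (2λ/π)Kⁿ_t` a.s. Here: an optional version
`igApproach` of the approach time (a.s. equal to it), the global bounded integrand `igGlob`
(truncated at it) and its martingale integral `K̃`; `Kⁿ = K̃` on `[0, ρₙ ∧ τ_δ]` by locality of the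
Itô integral (`IsItoIntegral.ae_eqOn_of_brownian`); `K̃` is frozen after the approach time
(`IsItoIntegral.ae_eq_stoppedProcess`); and every `t ∧ τ_δ < T_z` lies below some `ρₙ`.

## References

* J. Miller, S. Sheffield, *Imaginary geometry I*, PTRF 164 (2016) 553–705, arXiv:1201.1496:
  §2.3 Thm. 2.4 and its proof; Def. 2.1; Thm. 1.1, Fig. 1.9–1.10.
* G. F. Lawler, O. Schramm, W. Werner, *Conformal restriction: the chordal case*, JAMS 16 (2003),
  §8.3 (SLE(κ, ρ)).
* D. Revuz, M. Yor, *Continuous Martingales and Brownian Motion* (1999), Ch. IV Prop. (2.5),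
  (2.10), (2.11), Thm (3.3); Ch. XI Prop. (1.5).
-/

noncomputable section

open Set Filter MeasureTheory Complex
open _root_.Topology
open scoped NNReal Real
open Literature.Analysis.FunctionSpaces Literature.Probability.Process

namespace Literature.Probability.RandomPlanarGeometry

/-! ### The approach time is attained -/

namespace Loewner

variable {W : ℝ≥0 → ℝ} {z : ℂ}

/-- **At a finite approach time before absorption the flow is within `δ`**: if
`approachTime W z δ = T < T_z` then `|z_T| ≤ δ` (otherwise, by continuity, `|z_t| > δ` on a
neighbourhood `[0, T + ε)` and the infimum would be `≥ T + ε`). [folklore] -/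
theorem norm_centredMap_le_of_approachTime_eq_coe (hW : Continuous W) (hz : 0 < z.im) {δ : ℝ}
    {T : ℝ≥0} (hT : approachTime W z δ = T) (hTz : (T : WithTop ℝ≥0) < swallowingTime W z) :
    ‖centredMap W T z‖ ≤ δ := by
  by_contra hgt
  rw [not_le] at hgt
  have hzW : z ≠ W 0 := ne_driving_of_im_pos hz 0
  have hopen : IsOpen {r : ℝ≥0 | (r : WithTop ℝ≥0) < swallowingTime W z} :=
    isOpen_Iio.preimage WithTop.continuous_coe
  have hcont : ContinuousAt (fun r : ℝ≥0 ↦ ‖centredMap W r z‖) T :=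
    ((continuousOn_centredMap hW hzW).continuousAt (hopen.mem_nhds hTz)).norm
  have hev : ∀ᶠ r in 𝓝 T, δ < ‖centredMap W r z‖ := hcont.eventually (lt_mem_nhds hgt)
  -- an `ε`-neighbourhood to the right
  obtain ⟨ε, hε, hball⟩ := Metric.eventually_nhds_iff.1 hev
  have hfar : ∀ r : ℝ≥0, r < T + ε.toNNReal → δ < ‖centredMap W r z‖ := by
    intro r hr
    rcases lt_or_ge (r : WithTop ℝ≥0) (approachTime W z δ) with h1 | h1
    · exact lt_norm_centredMap_of_coe_lt_approachTime h1
    · rw [hT, WithTop.coe_le_coe] at h1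
      apply hball
      rw [NNReal.dist_eq, abs_of_nonneg (sub_nonneg.2 (NNReal.coe_le_coe.2 h1))]
      have : (r : ℝ) < T + ε := by
        have h2 : ((T + ε.toNNReal : ℝ≥0) : ℝ) = T + ε := by
          rw [NNReal.coe_add, Real.coe_toNNReal _ hε.le]
        rw [← h2]; exact_mod_cast hr
      linarith
  -- hence the approach time is `≥ T + ε`
  have hge : ((T + ε.toNNReal : ℝ≥0) : WithTop ℝ≥0) ≤ approachTime W z δ := by
    refine le_sInf ?_
    rintro _ ⟨r, hr, rfl⟩
    rw [WithTop.coe_le_coe]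
    by_contra hlt
    rw [not_le] at hlt
    have h1 := hfar r hlt
    rw [centredMap_apply] at h1
    exact absurd hr (not_le.2 h1)
  rw [hT, WithTop.coe_le_coe] at hge
  have : (0 : ℝ≥0) < ε.toNNReal := Real.toNNReal_pos.2 hε
  exact absurd hge (not_le.2 (lt_add_of_pos_right T this))

/-- If `approachTime W z δ = 0 < |z - W 0|`… contrapositive: a positive start-distance gives a
positive approach time (`|z_0| = |z - W_0| > δ` and continuity). [folklore] -/
theorem approachTime_pos (hW : Continuous W) (hz : 0 < z.im) {δ : ℝ} (hδz : δ < ‖z - (W 0 : ℂ)‖) :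
    0 < approachTime W z δ := by
  by_contra h0
  have h0' : approachTime W z δ = ((0 : ℝ≥0) : WithTop ℝ≥0) := le_antisymm (not_lt.1 h0) bot_le
  have hTz : ((0 : ℝ≥0) : WithTop ℝ≥0) < swallowingTime W z :=
    swallowingTime_pos_holds hW (ne_driving_of_im_pos hz 0)
  have h1 := norm_centredMap_le_of_approachTime_eq_coe hW hz h0' hTz
  rw [centredMap_zero hW (ne_driving_of_im_pos hz 0)] at h1
  exact absurd h1 (not_le.2 hδz)

end Loewner

namespace SLEKappaRho

/-! ### An optional version of the approach time -/

section Approach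

variable {Ω : Type*} {mΩ : MeasurableSpace Ω}

/-- **Optional version of the approach time**: the supremum over `k` of the rational debuts of
`{|z_t| < δ + 1/(k+1)}` for the adapted flow process `cmapProc V z` — an optional time of any raw
filtration to which `V` is adapted, equal on every continuous path to
`Loewner.approachTime (V · ω) z δ` (`igApproach_eq_of_continuous`). [folklore] -/
def igApproach (V : ℝ≥0 → Ω → ℝ) (z : ℂ) (δ : ℝ) (ω : Ω) : WithTop ℝ≥0 :=
  ⨆ k : ℕ, ratExceed (fun t ω ↦ -‖Loewner.cmapProc V z t ω‖) (-(δ + 1 / ((k : ℝ) + 1))) ω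

variable {V : ℝ≥0 → Ω → ℝ} {z : ℂ} {δ : ℝ}

/-- `igApproach` is an optional time for any filtration to which the driver is adapted
(`im z > 0`). [cite: Legall2016, Prop. 3.9] -/
theorem isOptionalTime_igApproach {𝓕 : Filtration ℝ≥0 mΩ} (hV : Adapted 𝓕 V) (hz : 0 < z.im) (δ : ℝ) :
    IsOptionalTime 𝓕 (igApproach V z δ) := by
  refine IsOptionalTime.iSup fun k ↦ isOptionalTime_ratExceed ?_ _
  intro t
  have h1 : Measurable[𝓕 t] fun ω ↦ Loewner.cmapProc V z t ω :=
    Loewner.measurable_cmapProc (mΩ := 𝓕 t) (fun s hs ↦ (hV s).mono (𝓕.mono hs) le_rfl) hz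
  exact (continuous_norm.measurable.comp h1).neg

/-- **On a continuous driving path the optional version is the approach time.**
(≤): at a finite approach time `T` one has `T < T_z` and `|z_T| ≤ δ < δ + 1/(k+1)`, so by
continuity rational times just after `T` qualify; (≥): if the supremum `l` were `< approachTime`,
then on the compact `[0, l']`, `l < l' < approachTime`, the continuous `|z_t|` stays `≥ δ + m`
(`m > 0`), while the `k`-th debut provides times `< l'` with `|z| < δ + 1/(k+1) < δ + m`.
[folklore] -/
theorem igApproach_eq_of_continuous {ω : Ω} (hc : Continuous fun s ↦ V s ω) (hz : 0 < z.im)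
    (hδ : 0 < δ) : igApproach V z δ ω = Loewner.approachTime (fun s ↦ V s ω) z δ := by
  set Wp : ℝ≥0 → ℝ := fun s ↦ V s ω with hWp
  have hzW : z ≠ Wp 0 := Loewner.ne_driving_of_im_pos hz 0
  set τ := Loewner.approachTime Wp z δ with hτ
  have hpath : ∀ t, Loewner.cmapProc V z t ω = Loewner.centredMap Wp t z := fun t ↦
    Loewner.cmapProc_eq_of_continuous hc t
  set g : ℝ≥0 → ℝ := fun t ↦ ‖Loewner.centredMap Wp t z‖ with hg
  have hU : ∀ t, (fun t ω ↦ -‖Loewner.cmapProc V z t ω‖) t ω = -g t := fun t ↦ by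
    simp only [hpath t, hg]
  have hopen : IsOpen {r : ℝ≥0 | (r : WithTop ℝ≥0) < Loewner.swallowingTime Wp z} :=
    isOpen_Iio.preimage WithTop.continuous_coe
  have hgcont : ContinuousOn g {r : ℝ≥0 | (r : WithTop ℝ≥0) < Loewner.swallowingTime Wp z} :=
    (Loewner.continuousOn_centredMap hc hzW).norm
  set σ : ℕ → WithTop ℝ≥0 := fun k ↦
    ratExceed (fun t ω ↦ -‖Loewner.cmapProc V z t ω‖) (-(δ + 1 / ((k : ℝ) + 1))) ω with hσ
  have hεpos : ∀ k : ℕ, (0 : ℝ) < 1 / ((k : ℝ) + 1) := fun k ↦ by positivity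
  -- every time before `τ` is before `T_z`
  have hbefore : ∀ r : ℝ≥0, (r : WithTop ℝ≥0) < τ → (r : WithTop ℝ≥0) < Loewner.swallowingTime Wp z := by
    intro r hr
    by_cases hTz : Loewner.swallowingTime Wp z = ⊤
    · rw [hTz]; exact WithTop.coe_lt_top r
    · exact hr.trans (Loewner.approachTime_lt_swallowingTime hc hz hδ hTz)
  apply le_antisymm
  · -- `⨆ σ_k ≤ τ`
    refine iSup_le fun k ↦ ?_
    induction hT : τ using WithTop.recTopCoe with
    | top => exact le_top
    | coe T =>
      have hTz : (T : WithTop ℝ≥0) < Loewner.swallowingTime Wp z := by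
        by_cases hTz : Loewner.swallowingTime Wp z = ⊤
        · rw [hTz]; exact WithTop.coe_lt_top T
        · have := Loewner.approachTime_lt_swallowingTime hc hz hδ hTz
          rwa [← hτ, hT] at this
      have hle : g T ≤ δ := Loewner.norm_centredMap_le_of_approachTime_eq_coe hc hz hT hTz
      -- `g < δ + ε` on a neighbourhood of `T`
      have hcontT : ContinuousAt g T := hgcont.continuousAt (hopen.mem_nhds hTz)
      have hev : ∀ᶠ r in 𝓝 T, g r < δ + 1 / ((k : ℝ) + 1) :=
        hcontT.eventually (gt_mem_nhds (by linarith [hεpos k]))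
      obtain ⟨ε, hε, hball⟩ := Metric.eventually_nhds_iff.1 hev
      -- `σ_k ≤ q` for every rational `q ∈ (T, T + ε)`, hence `σ_k ≤ T`
      refine le_of_forall_gt_imp_ge_of_dense fun c hc' ↦ ?_
      induction c using WithTop.recTopCoe with
      | top => exact le_top
      | coe c =>
        rw [WithTop.coe_lt_coe] at hc'
        obtain ⟨q, hq1, hq2⟩ := exists_rat_btwn (lt_min (NNReal.coe_lt_coe.2 hc') (lt_add_of_pos_right (T : ℝ) hε))
        have hq0 : (0 : ℝ) ≤ q := T.coe_nonneg.trans hq1.le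
        have hqT : (T : ℝ) < (q : ℝ).toNNReal := by rw [Real.coe_toNNReal _ hq0]; exact hq1
        have hdist : dist (q : ℝ).toNNReal T < ε := by
          rw [NNReal.dist_eq, Real.coe_toNNReal _ hq0, abs_of_nonneg (by linarith)]
          linarith [lt_min_iff.1 hq2]
        have hgq : g (q : ℝ).toNNReal < δ + 1 / ((k : ℝ) + 1) := hball hdist
        have hσle : σ k ≤ (((q : ℝ).toNNReal : ℝ≥0) : WithTop ℝ≥0) := by
          refine ratExceed_le ?_
          show -(δ + 1 / ((k : ℝ) + 1)) < -‖Loewner.cmapProc V z (q : ℝ).toNNReal ω‖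
          rw [hpath]; exact neg_lt_neg hgq
        refine hσle.trans (WithTop.coe_le_coe.2 ?_)
        rw [← NNReal.coe_le_coe, Real.coe_toNNReal _ hq0]
        exact (lt_min_iff.1 hq2).1.le
  · -- `τ ≤ ⨆ σ_k`
    by_contra hlt
    rw [not_le] at hlt
    obtain ⟨l, hl⟩ := WithTop.ne_top_iff_exists.1 (ne_top_of_lt hlt)
    -- a level `l'` with `l < l' < τ`
    obtain ⟨c, hlc, hcτ⟩ := exists_between hlt
    rw [← hl] at hlc
    obtain ⟨l', hl'⟩ := WithTop.ne_top_iff_exists.1 (ne_top_of_lt hcτ)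
    rw [← hl'] at hlc hcτ
    have hll' : l < l' := WithTop.coe_lt_coe.1 hlc
    -- on `[0, l']` the continuous `g` is `> δ`, hence `≥ δ + m`
    have hK : IsCompact (Icc (0 : ℝ≥0) l') := isCompact_Icc
    have hsub : Icc (0 : ℝ≥0) l' ⊆ {r : ℝ≥0 | (r : WithTop ℝ≥0) < Loewner.swallowingTime Wp z} :=
      fun r hr ↦ hbefore r (lt_of_le_of_lt (WithTop.coe_le_coe.2 hr.2) hcτ)
    obtain ⟨r₀, hr₀, hmin⟩ := hK.exists_isMinOn (nonempty_Icc.2 bot_le) (hgcont.mono hsub)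
    have hm : δ < g r₀ :=
      Loewner.lt_norm_centredMap_of_coe_lt_approachTime (lt_of_le_of_lt (WithTop.coe_le_coe.2 hr₀.2) hcτ)
    -- choose `k` with `1/(k+1) < g r₀ - δ` and `1/(k+1) < l' - l`
    obtain ⟨k, hk⟩ := exists_nat_gt (max (1 / (g r₀ - δ)) (1 / ((l' : ℝ) - l)))
    have hk1 : 1 / ((k : ℝ) + 1) < g r₀ - δ := by
      have h1 : 1 / (g r₀ - δ) < (k : ℝ) + 1 := by linarith [le_max_left (1 / (g r₀ - δ)) (1 / ((l' : ℝ) - l))]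
      rw [div_lt_iff₀ (by positivity)]
      rw [div_lt_iff₀ (by linarith)] at h1
      linarith
    have hk2 : 1 / ((k : ℝ) + 1) < (l' : ℝ) - l := by
      have hgap : (0 : ℝ) < (l' : ℝ) - l := sub_pos.2 (NNReal.coe_lt_coe.2 hll')
      have h1 : 1 / ((l' : ℝ) - l) < (k : ℝ) + 1 := by linarith [le_max_right (1 / (g r₀ - δ)) (1 / ((l' : ℝ) - l))]
      rw [div_lt_iff₀ (by positivity)]
      rw [div_lt_iff₀ hgap] at h1
      linarith
    -- the `k`-th debut is `≤ l`, so it provides a rational time `< l + 1/(k+1) < l'`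
    have hσk : σ k ≤ (l : WithTop ℝ≥0) := by rw [hl]; exact le_iSup σ k
    have hσlt : σ k < ((l + (1 / ((k : ℝ) + 1)).toNNReal : ℝ≥0) : WithTop ℝ≥0) :=
      lt_of_le_of_lt hσk (WithTop.coe_lt_coe.2 (lt_add_of_pos_right l (Real.toNNReal_pos.2 (hεpos k))))
    obtain ⟨q, hq, hqlt⟩ := ratExceed_lt_iff.1 hσlt
    change -(δ + 1 / ((k : ℝ) + 1)) < -‖Loewner.cmapProc V z (q : ℝ).toNNReal ω‖ at hq
    rw [hpath] at hq
    have hgq : g (q : ℝ).toNNReal < δ + 1 / ((k : ℝ) + 1) := by linarith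
    -- `q⁺ ∈ [0, l']`
    have hql' : (q : ℝ).toNNReal ≤ l' := by
      have h1 : ((q : ℝ).toNNReal : ℝ) < l + 1 / ((k : ℝ) + 1) := by
        have := WithTop.coe_lt_coe.1 hqlt
        rw [← NNReal.coe_lt_coe, NNReal.coe_add, Real.coe_toNNReal _ (hεpos k).le] at this
        exact this
      rw [← NNReal.coe_le_coe]
      linarith
    have hge := hmin (show (q : ℝ).toNNReal ∈ Icc (0 : ℝ≥0) l' from ⟨bot_le, hql'⟩)
    rw [mem_setOf_eq] at hge
    linarith

end Approach

/-! ### The global integrand and its martingale integral -/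

section Global

variable (κ : ℝ≥0) (W' : ℝ≥0 → (ℝ≥0 → ℝ) → ℝ) (z : ℂ) (δ : ℝ)

/-- **The global Itô integrand of `𝔥`**: `𝟙_{s ≤ τ̃} clamp_{√κ/δ}(-√κ ỹ_s/(x̃_s² + ỹ_s²))` with the
optional approach time `τ̃ = igApproach W' z δ` and the progressive flows `x̃ = xReg W' z`,
`ỹ = yReg W' z`; on good paths, up to the approach time, it is the honest diffusion coefficient
`-√κ y_s/|z_s|²` of `arctan(x/y)` (the clamp is inactive as `|y/|z|²| ≤ 1/|z| ≤ 1/δ`). [folklore] -/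
def igGlobU : ℝ≥0 → (ℝ≥0 → ℝ) → ℝ := fun s ω ↦
  igClamp (Real.sqrt κ * δ⁻¹)
    (-Real.sqrt κ * Loewner.yReg W' z s ω / (Loewner.xReg W' z s ω ^ 2 + Loewner.yReg W' z s ω ^ 2))

/-- The truncation of `igGlobU` at the optional approach time. [folklore] -/
def igGlob : ℝ≥0 → (ℝ≥0 → ℝ) → ℝ := trunc (igApproach W' z δ) (igGlobU κ W' z δ)

variable {κ W' z δ} {ρ : ℝ} {W J : ℝ≥0 → (ℝ≥0 → ℝ) → ℝ}

/-- `igGlobU` is progressively measurable. [folklore] -/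
theorem isStronglyProgressive_igGlobU (h : RegularPair κ ρ W W' J) (hz : 0 < z.im) (δ : ℝ) :
    IsStronglyProgressive brownianFiltration (igGlobU κ W' z δ) := by
  have hx := h.isStronglyProgressive_xReg hz
  have hy := h.isStronglyProgressive_yReg hz
  have hQ : IsStronglyProgressive brownianFiltration fun s ω ↦
      (Loewner.xReg W' z s ω ^ 2 + Loewner.yReg W' z s ω ^ 2)⁻¹ := fun i ↦
    ((((IsStronglyProgressive.continuous_comp hx (continuous_pow 2)).add
      (IsStronglyProgressive.continuous_comp hy (continuous_pow 2))) i).measurable.inv).stronglyMeasurable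
  have h1 : IsStronglyProgressive brownianFiltration fun s ω ↦
      -Real.sqrt κ * Loewner.yReg W' z s ω / (Loewner.xReg W' z s ω ^ 2 + Loewner.yReg W' z s ω ^ 2) := by
    simpa [div_eq_mul_inv] using ((isStronglyProgressive_const _ (-Real.sqrt κ)).mul hy).mul hQ
  exact IsStronglyProgressive.continuous_comp h1 (continuous_igClamp _)

/-- `igGlob` is progressively measurable. [folklore] -/
theorem isStronglyProgressive_igGlob (h : RegularPair κ ρ W W' J) (hz : 0 < z.im) (δ : ℝ) :
    IsStronglyProgressive brownianFiltration (igGlob κ W' z δ) :=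
  isStronglyProgressive_trunc (isStronglyProgressive_igGlobU h hz δ)
    (isOptionalTime_igApproach h.adapted hz δ)

/-- `|igGlobU| ≤ √κ/δ` (`δ > 0`). [folklore] -/
theorem abs_igGlobU_le (hδ : 0 < δ) (s : ℝ≥0) (ω : ℝ≥0 → ℝ) : |igGlobU κ W' z δ s ω| ≤ Real.sqrt κ * δ⁻¹ :=
  abs_igClamp_le (by positivity) _

/-- `|igGlob| ≤ √κ/δ` (`δ > 0`). [folklore] -/
theorem abs_igGlob_le (hδ : 0 < δ) (s : ℝ≥0) (ω : ℝ≥0 → ℝ) : |igGlob κ W' z δ s ω| ≤ Real.sqrt κ * δ⁻¹ := by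
  rw [igGlob, trunc_apply]
  split_ifs
  · exact abs_igGlobU_le hδ s ω
  · rw [abs_zero]; positivity

/-- **The global martingale `K̃ = ∫ igGlob dB`** exists, is a martingale with a.s. continuous paths,
and is a.s. FROZEN after the optional approach time: `K̃_t = K̃_{t ∧ τ̃}` for all `t`
(`IsItoIntegral.ae_eq_stoppedProcess` with the untruncated integral). [cite: RevuzYor1999, Ch. IV Prop. (2.5) and Prop. (2.10)(ii)] -/
theorem exists_isItoIntegral_igGlob (h : RegularPair κ ρ W W' J) (hz : 0 < z.im) (hδ : 0 < δ) :
    ∃ K : ℝ≥0 → (ℝ≥0 → ℝ) → ℝ,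
      IsItoIntegral (igGlob κ W' z δ) brownian K brownianFiltration preWienerMeasure ∧
      Martingale K brownianFiltration preWienerMeasure ∧
      (∀ᵐ ω ∂preWienerMeasure, Continuous fun t ↦ K t ω) ∧
      ∀ᵐ ω ∂preWienerMeasure, ∀ t : ℝ≥0,
        K t ω = K ((min (t : WithTop ℝ≥0) (igApproach W' z δ ω)).untopA) ω := by
  haveI := isProbabilityMeasure_preWienerMeasure'
  obtain ⟨K, hK, hKM, -⟩ := exists_isItoIntegral_of_abs_le (isStronglyProgressive_igGlob h hz δ)
    fun s ω ↦ abs_igGlob_le hδ s ω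
  obtain ⟨K₀, hK₀, -, -⟩ := exists_isItoIntegral_of_abs_le (isStronglyProgressive_igGlobU h hz δ)
    fun s ω ↦ abs_igGlobU_le hδ s ω
  have hfrozen := IsItoIntegral.ae_eq_stoppedProcess martingale_brownian_holds
    martingale_brownian_sq_sub_holds memLp_two_brownian continuous_brownian
    (measurable_toNNReal_of_isStronglyProgressive (isStronglyProgressive_igGlobU h hz δ))
    (isOptionalTime_igApproach h.adapted hz δ) hK₀ hK
  refine ⟨K, hK, hKM, hK.continuous, ?_⟩
  filter_upwards [hfrozen] with ω hω t
  rw [hω t, hω ((min (t : WithTop ℝ≥0) (igApproach W' z δ ω)).untopA)]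
  simp only [stoppedProcess]
  congr 1
  rw [coe_untopA_min, min_assoc, min_self]

end Global

/-! ### Identification of the integrands on good paths -/

namespace GoodPath

variable {κ : ℝ≥0} {ρ : ℝ} {O W W' J : ℝ≥0 → (ℝ≥0 → ℝ) → ℝ} {ω : ℝ≥0 → ℝ} {z : ℂ} {n : ℕ} {δ : ℝ}

/-- On a good path, up to `ρₙ`, the Itô integrand of `arctan(w)` is the honest
`-√κ y_s/|z_s|²`. [folklore] -/
theorem igHDiffusion_eq (hω : GoodPath κ ρ O W W' J ω) (hz : 0 < z.im) {s : ℝ≥0}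
    (hs : (s : WithTop ℝ≥0) ≤ igLocTime W' J z n ω) :
    igHDiffusion κ W' J z n s ω = -Real.sqrt κ * (Loewner.centredMap (fun r ↦ W r ω) s z).im /
      ‖Loewner.centredMap (fun r ↦ W r ω) s z‖ ^ 2 := by
  have hY : 0 < igY W' J z n s ω := igY_pos hz s ω
  have hQ : 0 < igX W' J z n s ω ^ 2 + igY W' J z n s ω ^ 2 := by positivity
  have h1 : igHDiffusion κ W' J z n s ω = -Real.sqrt κ * igY W' J z n s ω /
      (igX W' J z n s ω ^ 2 + igY W' J z n s ω ^ 2) := by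
    simp only [igHDiffusion, igWDiffusion, igW, igInvY, igDiffusion, trunc_of_le hs, deriv_arctan_apply]
    field_simp
    ring
  rw [h1, hω.igX_eq_of_le hz hs, hω.igY_eq_of_le hz hs, Complex.sq_norm, normSq_apply]
  ring

/-- On a good path the optional approach time is the approach time of the flow of `W`. [folklore] -/
theorem igApproach_eq (hω : GoodPath κ ρ O W W' J ω) (hz : 0 < z.im) (hδ : 0 < δ) :
    igApproach W' z δ ω = Loewner.approachTime (fun r ↦ W r ω) z δ := by
  rw [igApproach_eq_of_continuous hω.continuous hz hδ, hω.path_eq]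

/-- On a good path with POSITIVE approach time, up to the approach time and before `T_z`, the
global integrand is the honest `-√κ y_s/|z_s|²` (`|z_s| ≥ δ` there, so the clamp is inactive; at
`s = 0`, `|z| > δ`). [folklore] -/
theorem igGlob_eq (hω : GoodPath κ ρ O W W' J ω) (hz : 0 < z.im) (hδ : 0 < δ)
    (hpos : 0 < Loewner.approachTime (fun r ↦ W r ω) z δ) {s : ℝ≥0}
    (hs : (s : WithTop ℝ≥0) ≤ Loewner.approachTime (fun r ↦ W r ω) z δ)
    (hsT : (s : WithTop ℝ≥0) < Loewner.swallowingTime (fun r ↦ W r ω) z) :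
    igGlob κ W' z δ s ω = -Real.sqrt κ * (Loewner.centredMap (fun r ↦ W r ω) s z).im /
      ‖Loewner.centredMap (fun r ↦ W r ω) s z‖ ^ 2 := by
  have hW := hω.continuous_snd
  have hs' : (s : WithTop ℝ≥0) ≤ igApproach W' z δ ω := by rwa [hω.igApproach_eq hz hδ]
  rw [igGlob, trunc_of_le hs', igGlobU, hω.xReg_eq hz hsT, hω.yReg_eq hz, Loewner.imFlowStop_of_lt hsT,
    ← Loewner.im_centredMap]
  have hsq : (Loewner.centredMap (fun r ↦ W r ω) s z).re ^ 2 + (Loewner.centredMap (fun r ↦ W r ω) s z).im ^ 2 =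
      ‖Loewner.centredMap (fun r ↦ W r ω) s z‖ ^ 2 := by rw [Complex.sq_norm, normSq_apply]; ring
  rw [hsq]
  apply igClamp_of_abs_le
  -- `|√κ y/|z|²| ≤ √κ/δ`
  have hδs : δ ≤ ‖Loewner.centredMap (fun r ↦ W r ω) s z‖ := by
    rcases (show (0 : ℝ≥0) ≤ s from bot_le).eq_or_lt with h0 | h0
    · -- `s = 0`: `|z| > δ` because the approach time is positive
      rw [← h0, Loewner.centredMap_zero hW (Loewner.ne_driving_of_im_pos (W := fun r ↦ W r ω) hz 0)]
      by_contra hlt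
      rw [not_le] at hlt
      have : Loewner.approachTime (fun r ↦ W r ω) z δ ≤ ((0 : ℝ≥0) : WithTop ℝ≥0) := by
        refine Loewner.approachTime_le ?_
        rw [Loewner.map_zero_apply hW (Loewner.ne_driving_of_im_pos (W := fun r ↦ W r ω) hz 0)]
        exact hlt.le
      exact absurd (lt_of_lt_of_le hpos this) (lt_irrefl _)
    · exact Loewner.le_norm_centredMap_of_coe_le_approachTime hW hz h0 hs hsT
  have hn : 0 < ‖Loewner.centredMap (fun r ↦ W r ω) s z‖ := hδ.trans_le hδs
  rw [abs_div, abs_mul, abs_neg, abs_of_nonneg (Real.sqrt_nonneg _), abs_of_pos (pow_pos hn 2),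
    div_le_iff₀ (pow_pos hn 2)]
  have him : |(Loewner.centredMap (fun r ↦ W r ω) s z).im| ≤ ‖Loewner.centredMap (fun r ↦ W r ω) s z‖ :=
    abs_im_le_norm _
  have h2 : δ⁻¹ * ‖Loewner.centredMap (fun r ↦ W r ω) s z‖ ^ 2 ≥ ‖Loewner.centredMap (fun r ↦ W r ω) s z‖ := by
    rw [ge_iff_le, ← div_le_iff₀' (inv_pos.2 hδ), div_inv_eq_mul]
    nlinarith
  calc Real.sqrt κ * |(Loewner.centredMap (fun r ↦ W r ω) s z).im|
      ≤ Real.sqrt κ * ‖Loewner.centredMap (fun r ↦ W r ω) s z‖ := by gcongr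
    _ ≤ Real.sqrt κ * (δ⁻¹ * ‖Loewner.centredMap (fun r ↦ W r ω) s z‖ ^ 2) := by gcongr
    _ = Real.sqrt κ * δ⁻¹ * ‖Loewner.centredMap (fun r ↦ W r ω) s z‖ ^ 2 := by ring

/-- **Exhaustion**: on a good path of a regular version every time before the swallowing time is
below `ρₙ` for some `n` (`y` is bounded below on `[0, u]` by `y_u > 0`; `|W|`, `∫₀ J ≥ 0`
(nondecreasing) and the clock are bounded on `[0, u]`). [cite: RohdeSchramm2005, Lemma 6.3 (proof)] -/
theorem exists_coe_le_igLocTime (hω : GoodPath κ ρ O W W' J ω) (hreg : RegularPair κ ρ W W' J)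
    (hz : 0 < z.im) {u : ℝ≥0} (hu : (u : WithTop ℝ≥0) < Loewner.swallowingTime (fun r ↦ W r ω) z) :
    ∃ n : ℕ, (u : WithTop ℝ≥0) ≤ igLocTime W' J z n ω := by
  have hW := hω.continuous_snd
  have hyu : 0 < Loewner.imFlowStop (fun r ↦ W r ω) z u := (Loewner.imFlowStop_pos_iff hW hz).2 hu
  -- bounds on `[0, u]`
  obtain ⟨C, hC⟩ : ∃ C, ∀ s ∈ Icc (0 : ℝ≥0) u, |W s ω| ≤ C := by
    obtain ⟨C, hC⟩ := isCompact_Icc.exists_bound_of_continuousOn (hW.continuousOn (s := Icc 0 u))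
    exact ⟨C, fun s hs ↦ by simpa [Real.norm_eq_abs] using hC s hs⟩
  have hImono : ∀ s : ℝ≥0, s ≤ u → timeIntegral J s ω ≤ timeIntegral J u ω := by
    intro s hs
    simp only [timeIntegral]
    exact intervalIntegral.integral_mono_interval le_rfl s.coe_nonneg (NNReal.coe_le_coe.2 hs)
      (Eventually.of_forall fun r ↦ hreg.nonneg _ _) (hω.intervalIntegrable u)
  -- choose `n`
  obtain ⟨N₁, hN₁⟩ := exists_nat_gt (z.im / Loewner.imFlowStop (fun r ↦ W r ω) z u)
  obtain ⟨N₂, hN₂⟩ := exists_nat_gt (max (max C (timeIntegral J u ω)) (u : ℝ))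
  refine ⟨max N₁ N₂, ?_⟩
  set n := max N₁ N₂ with hn
  have hn₁ : (N₁ : ℝ) ≤ n := by exact_mod_cast le_max_left N₁ N₂
  have hn₂ : (N₂ : ℝ) ≤ n := by exact_mod_cast le_max_right N₁ N₂
  have hlevel : igLevel z n < Loewner.imFlowStop (fun r ↦ W r ω) z u := by
    rw [igLevel, div_lt_iff₀ (by positivity)]
    have h1 : z.im / Loewner.imFlowStop (fun r ↦ W r ω) z u < n + 2 := by linarith
    rw [div_lt_iff₀ hyu] at h1
    linarith
  have hCn : C < n + 1 := by linarith [le_max_left (max C (timeIntegral J u ω)) (u : ℝ), le_max_left C (timeIntegral J u ω)]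
  have hIn : timeIntegral J u ω < n + 1 := by
    linarith [le_max_left (max C (timeIntegral J u ω)) (u : ℝ), le_max_right C (timeIntegral J u ω)]
  have hun : (u : ℝ) ≤ n + 1 := by linarith [le_max_right (max C (timeIntegral J u ω)) (u : ℝ)]
  simp only [igLocTime]
  refine le_min ?_ (le_min ?_ (le_min ?_ ?_))
  · refine le_ratExceed_of_forall fun q hq ↦ ?_
    show -Loewner.yReg W' z (q : ℝ).toNNReal ω ≤ -igLevel z n
    rw [hω.yReg_eq hz]
    have := Loewner.imFlowStop_antitone hW hz hq
    linarith
  · refine le_ratExceed_of_forall fun q hq ↦ ?_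
    show |W' (q : ℝ).toNNReal ω| ≤ n + 1
    rw [hω.eq]
    exact (hC _ ⟨bot_le, hq⟩).trans hCn.le
  · refine le_ratExceed_of_forall fun q hq ↦ ?_
    show timeIntegral J (q : ℝ).toNNReal ω ≤ n + 1
    exact (hImono _ hq).trans hIn.le
  · exact_mod_cast hun

/-- **On a good path of a regular version, `𝔥^{(n)}` at a time `u ≤ ρₙ` is `𝔥_u(z)`** of the pair
`(O, W)`: the slope form `Loewner.imaginaryHarmonic_eq_arctan` at `u < T_z` with `X_u = x_u`,
`Y_u = y_u`, `Z'_u = W_u - O_u`, `A_u = arg g_u'(z)`. [cite: MillerSheffield2016, Thm. 1.1 and Thm. 2.4] -/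
theorem igH_eq_imaginaryHarmonicProcess (hω : GoodPath κ ρ O W W' J ω) (hreg : RegularPair κ ρ W W' J)
    (hz : 0 < z.im) {u : ℝ≥0} (hu : (u : WithTop ℝ≥0) ≤ igLocTime W' J z n ω) :
    igH κ ρ W' J z n u ω = imaginaryHarmonicProcess κ ρ O W z u ω := by
  have hW := hω.continuous_snd
  have huT := hω.coe_lt_swallowingTime hz hu
  rw [imaginaryHarmonicProcess]
  show _ = imaginaryHarmonic κ ρ (fun s ↦ W s ω) (fun s ↦ O s ω) z u
  rw [Loewner.imaginaryHarmonic_eq_arctan hW hz κ ρ (fun s ↦ O s ω) huT, igH, igW, igV, igR, igInvY,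
    hω.igX_eq_of_le hz hu, hω.igY_eq_of_le hz hu, hω.igZp_eq_of_le hreg hu, hω.igA_eq hz,
    igClock_eq_of_le hu, ← hω.snd_sub_fst u]
  simp only [div_eq_mul_inv]

/-- On a good path `𝔥_0(z) = λ - ((2+ρ)λ/π) arg z`. [cite: MillerSheffield2016, Fig. 1.10] -/
theorem imaginaryHarmonicProcess_zero (hω : GoodPath κ ρ O W W' J ω) (hz : 0 < z.im) :
    imaginaryHarmonicProcess κ ρ O W z 0 ω = igLambda κ - ((2 + ρ) * igLambda κ / π) * arg z := by
  have hW := hω.continuous_snd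
  have hW0 : W 0 ω = 0 := by
    have h1 := hω.eq_brownian 0
    rw [hω.eq 0] at h1
    rw [h1, timeIntegral_apply_zero]
    simp [brownian_zero]
  have hO0 : O 0 ω = 0 := by rw [hω.fst_eq 0, timeIntegral_apply_zero]; simp
  have hz0 : z ≠ 0 := by
    intro h; rw [h, Complex.zero_im] at hz; exact lt_irrefl _ hz
  exact imaginaryHarmonic_zero (U := fun s ↦ W s ω) (V := fun s ↦ O s ω) hW hW0 hO0 hz0

end GoodPath

/-! ### Locality: the localised integrals agree with the global one -/

section Locality

variable {κ : ℝ≥0} {ρ : ℝ} {O W W' J : ℝ≥0 → (ℝ≥0 → ℝ) → ℝ} {z : ℂ} {n : ℕ} {δ : ℝ}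

/-- Two real functions on `ℝ≥0`, continuous at `s > 0`, which agree on `[0, s)`, agree at `s`.
[folklore] -/
theorem eq_of_eqOn_Iio {f g : ℝ≥0 → ℝ} {s : ℝ≥0} (hs : 0 < s) (hf : ContinuousAt f s)
    (hg : ContinuousAt g s) (h : ∀ r, r < s → f r = g r) : f s = g s := by
  have hmem : s ∈ closure (Iio s) := by
    rw [closure_Iio' (show (Iio s).Nonempty from ⟨0, hs⟩)]; exact self_mem_Iic
  have h1 : Tendsto f (𝓝[Iio s] s) (𝓝 (f s)) := hf.tendsto.mono_left nhdsWithin_le_nhds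
  have h2 : Tendsto g (𝓝[Iio s] s) (𝓝 (g s)) := hg.tendsto.mono_left nhdsWithin_le_nhds
  have h3 : Tendsto g (𝓝[Iio s] s) (𝓝 (f s)) :=
    h1.congr' (eventually_nhdsWithin_of_forall fun r hr ↦ h r hr)
  haveI : (𝓝[Iio s] s).NeBot := mem_closure_iff_nhdsWithin_neBot.1 hmem
  exact tendsto_nhds_unique h3 h2

/-- **`Kⁿ = K̃` on `[0, ρₙ ∧ τ_δ]` almost surely**: the localised Itô integrand `igHDiffusion` (of
`𝔥^{(n)}`) and the global `igGlob` coincide on good paths up to `ρₙ ∧ τ_δ` (both are the honest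
`-√κ y/|z|²` there), so their Itô integrals coincide there (`IsItoIntegral.ae_eqOn_of_brownian` on
`[0, q⁺]` for every rational `q`, then continuity at the endpoint). [cite: RevuzYor1999, Ch. IV Prop. (2.11)] -/
theorem ae_eq_of_isItoIntegral (h : RegularPair κ ρ W W' J)
    (hgood : ∀ᵐ ω ∂preWienerMeasure, GoodPath κ ρ O W W' J ω) (hz : 0 < z.im) (hδ : 0 < δ)
    {Kn K : ℝ≥0 → (ℝ≥0 → ℝ) → ℝ}
    (hKn : IsItoIntegral (igHDiffusion κ W' J z n) brownian Kn brownianFiltration preWienerMeasure)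
    (hK : IsItoIntegral (igGlob κ W' z δ) brownian K brownianFiltration preWienerMeasure) :
    ∀ᵐ ω ∂preWienerMeasure, ∀ s : ℝ≥0, (s : WithTop ℝ≥0) ≤ igLocTime W' J z n ω →
      (s : WithTop ℝ≥0) ≤ Loewner.approachTime (fun r ↦ W r ω) z δ → Kn s ω = K s ω := by
  -- the events `E_q`
  set E : ℚ → Set (ℝ≥0 → ℝ) := fun q ↦ {ω | GoodPath κ ρ O W W' J ω ∧
      (((q : ℝ).toNNReal : ℝ≥0) : WithTop ℝ≥0) ≤ igLocTime W' J z n ω ∧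
      (((q : ℝ).toNNReal : ℝ≥0) : WithTop ℝ≥0) ≤ Loewner.approachTime (fun r ↦ W r ω) z δ ∧
      0 < Loewner.approachTime (fun r ↦ W r ω) z δ} with hE
  have hHm : ∀ᵐ ω ∂preWienerMeasure, Measurable fun s : ℝ ↦ igHDiffusion κ W' J z n s.toNNReal ω :=
    ae_of_all _ fun ω ↦ measurable_path_of_isStronglyProgressive (isStronglyProgressive_igHDiffusion h hz n) ω
  have hq : ∀ q : ℚ, ∀ᵐ ω ∂preWienerMeasure, ω ∈ E q → ∀ s ≤ (q : ℝ).toNNReal, Kn s ω = K s ω := by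
    intro q
    refine hKn.ae_eqOn_of_brownian hK hHm (E := E q) (t := (q : ℝ).toNNReal) ?_
    rintro ω ⟨hω, hρn, hτ, hpos⟩ s hs
    have hs1 : (s : WithTop ℝ≥0) ≤ igLocTime W' J z n ω := (WithTop.coe_le_coe.2 hs).trans hρn
    have hs2 : (s : WithTop ℝ≥0) ≤ Loewner.approachTime (fun r ↦ W r ω) z δ := (WithTop.coe_le_coe.2 hs).trans hτ
    rw [hω.igHDiffusion_eq hz hs1, hω.igGlob_eq hz hδ hpos hs2 (hω.coe_lt_swallowingTime hz hs1)]
  rw [← ae_all_iff] at hq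
  filter_upwards [hgood, hq, hKn.continuous, hK.continuous] with ω hω hqω hKnc hKc s hs1 hs2
  rcases (show (0 : ℝ≥0) ≤ s from bot_le).eq_or_lt with h0 | h0
  · rw [← h0, hKn.apply_zero, hK.apply_zero]
  have hpos : 0 < Loewner.approachTime (fun r ↦ W r ω) z δ :=
    lt_of_lt_of_le (by exact_mod_cast h0) hs2
  -- agreement on `[0, s)` through rational times, then at `s` by continuity
  refine eq_of_eqOn_Iio h0 hKnc.continuousAt hKc.continuousAt fun r hr ↦ ?_
  obtain ⟨q, hq1, hq2⟩ := exists_rat_btwn (NNReal.coe_lt_coe.2 hr)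
  have hq0 : (0 : ℝ) ≤ q := r.coe_nonneg.trans hq1.le
  have hrq : r ≤ (q : ℝ).toNNReal := by
    rw [← NNReal.coe_le_coe, Real.coe_toNNReal _ hq0]; exact hq1.le
  have hqs : (q : ℝ).toNNReal ≤ s := by
    rw [← NNReal.coe_le_coe, Real.coe_toNNReal _ hq0]; exact hq2.le
  have hmem : ω ∈ E q :=
    ⟨hω, (WithTop.coe_le_coe.2 hqs).trans hs1, (WithTop.coe_le_coe.2 hqs).trans hs2, hpos⟩
  exact hqω q hmem r hrq

end Locality

/-! ### Assembly -/

section Assembly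

variable {κ : ℝ≥0} {ρ : ℝ} {O W : ℝ≥0 → (ℝ≥0 → ℝ) → ℝ} {z : ℂ} {δ : ℝ}

/-- **Miller–Sheffield 2016, Theorem 2.4 (⇒) for the tree's SLE(κ, ρ), almost-sure form.** For
`κ > 0`, `ρ > -2`, an SLE(κ, ρ) driving pair `(O, W)`, `z ∈ ℍ` and `δ > 0`, there is a martingale `K`
of the raw Brownian filtration with a.s. continuous paths such that, with
`M = 𝔥_0(z) + (2λ/π) K` (`𝔥_0(z) = λ - ((2+ρ)λ/π) arg z`), almost surely
`𝔥_{t ∧ τ_δ}(z) = M_t` for all `t`, `τ_δ` the approach time `inf{t : |g_t(z) - W_t| ≤ δ}`.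
[cite: MillerSheffield2016, Thm. 2.4 (forward direction)] -/
theorem exists_martingale_stoppedProcess_imaginaryHarmonicProcess (hκ : 0 < κ) (hρ : -2 < ρ)
    (hOW : IsSLEKappaRhoPair κ ρ O W) (hz : 0 < z.im) (hδ : 0 < δ) :
    ∃ K : ℝ≥0 → (ℝ≥0 → ℝ) → ℝ, Martingale K brownianFiltration preWienerMeasure ∧
      (∀ᵐ ω ∂preWienerMeasure, Continuous fun t ↦ K t ω) ∧
      ∀ᵐ ω ∂preWienerMeasure, ∀ t : ℝ≥0,
        stoppedProcess (imaginaryHarmonicProcess κ ρ O W z)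
            (fun ω ↦ Loewner.approachTime (fun s ↦ W s ω) z δ) t ω =
          (igLambda κ - ((2 + ρ) * igLambda κ / π) * arg z) + 2 * igLambda κ / π * K t ω := by
  obtain ⟨W', J, hreg, hgood⟩ := hOW.exists_regularPair_goodPath hκ hρ
  obtain ⟨K, hK, hKM, hKc, hKfro⟩ := exists_isItoIntegral_igGlob hreg hz hδ (κ := κ)
  have hloc : ∀ n : ℕ, ∃ Kn : ℝ≥0 → (ℝ≥0 → ℝ) → ℝ,
      (∀ᵐ ω ∂preWienerMeasure, ∀ t : ℝ≥0,
        igH κ ρ W' J z n t ω = igH κ ρ W' J z n 0 ω + 2 * igLambda κ / π * Kn t ω) ∧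
      ∀ᵐ ω ∂preWienerMeasure, ∀ s : ℝ≥0, (s : WithTop ℝ≥0) ≤ igLocTime W' J z n ω →
        (s : WithTop ℝ≥0) ≤ Loewner.approachTime (fun r ↦ W r ω) z δ → Kn s ω = K s ω := by
    intro n
    obtain ⟨Kn, hKn, -, hid⟩ := exists_martingale_igH hreg hgood hz hκ n (z := z) (O := O)
    exact ⟨Kn, hid, ae_eq_of_isItoIntegral hreg hgood hz hδ hKn hK⟩
  choose Kn hid hKloc using hloc
  rw [← ae_all_iff] at hid hKloc
  refine ⟨K, hKM, hKc, ?_⟩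
  filter_upwards [hgood, hKfro, hid, hKloc] with ω hω hfro hidω hlocω t
  set τ := Loewner.approachTime (fun s ↦ W s ω) z δ with hτ
  set u : ℝ≥0 := (min (t : WithTop ℝ≥0) τ).untopA with hu
  have huτ : (u : WithTop ℝ≥0) ≤ τ := coe_untopA_min_le t τ
  have hW := hω.continuous_snd
  have huT : (u : WithTop ℝ≥0) < Loewner.swallowingTime (fun s ↦ W s ω) z := by
    by_cases hT : Loewner.swallowingTime (fun s ↦ W s ω) z = ⊤
    · rw [hT]; exact WithTop.coe_lt_top u
    · exact lt_of_le_of_lt huτ (Loewner.approachTime_lt_swallowingTime hW hz hδ hT)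
  obtain ⟨n, hn⟩ := hω.exists_coe_le_igLocTime hreg hz huT
  show imaginaryHarmonicProcess κ ρ O W z u ω = _
  rw [← hω.igH_eq_imaginaryHarmonicProcess hreg hz hn, hidω n u,
    hω.igH_eq_imaginaryHarmonicProcess hreg hz (show ((0 : ℝ≥0) : WithTop ℝ≥0) ≤ igLocTime W' J z n ω from bot_le),
    hω.imaginaryHarmonicProcess_zero hz, hlocω n u hn huτ, hfro t, hω.igApproach_eq hz hδ]

end Assembly

end SLEKappaRho

/-! ### The corrected named fact and its discharge -/

/-- **Miller–Sheffield 2016, Theorem 2.4 (⇒), one left force point, ALMOST-SURE FORM** (corrected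
statement of the named fact `MillerSheffield2016_thm24_forward` of `ImaginaryGeometryHarmonic.lean`,
same cite). For `κ > 0`, `ρ > -2` (continuation threshold `= ∞`), every SLE(κ, ρ) driving pair
`(O, W)` of the tree (`IsSLEKappaRhoPair`), every `z ∈ ℍ` and `δ > 0`: the process `t ↦ 𝔥_t(z)`
stopped at the approach time `inf{t : |g_t(z) - W_t| ≤ δ}` is INDISTINGUISHABLE FROM A CONTINUOUS
LOCAL MARTINGALE of the Brownian filtration under the pre-Wiener measure: there is a process `M`,
a local martingale for `brownianFiltration` under `preWienerMeasure` with almost surely continuous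
paths, such that almost surely `𝔥_{t∧τ_δ}(z) = M_t` for all `t`.
**Discrepancy with `MillerSheffield2016_thm24_forward`.** That def asserts
`IsLocalMartingale (stoppedProcess (imaginaryHarmonicProcess κ ρ O W z) τ_δ)` itself, which through
Mathlib's `Martingale ⊇ StronglyAdapted` is a SURE adaptedness requirement on a process built
pathwise from `(O, W)`; but `O_t = -2∫₀ᵗ du/(√κ X_u)` and `W = √κ X + O` (for an arbitrary Bessel
process `X` with only a.s.-continuous paths) are not known to be adapted to the raw Brownian
filtration, so that statement is not the content of the source, which works under the usual
conditions (Def. 2.1) where "is a continuous local martingale" is meant up to indistinguishability.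
See the module docstring. [cite: MillerSheffield2016, Thm. 2.4 (forward direction), with Thm. 1.1 / Fig. 1.10 for 𝔥_t] -/
def MillerSheffield2016_thm24_forward_ae : Prop :=
  ∀ (κ : ℝ≥0) (ρ : ℝ), 0 < κ → -2 < ρ → ∀ O W : ℝ≥0 → (ℝ≥0 → ℝ) → ℝ, IsSLEKappaRhoPair κ ρ O W →
    ∀ z : ℂ, 0 < z.im → ∀ δ : ℝ, 0 < δ →
      ∃ M : ℝ≥0 → (ℝ≥0 → ℝ) → ℝ,
        IsLocalMartingale M brownianFiltration preWienerMeasure ∧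
        (∀ᵐ ω ∂preWienerMeasure, Continuous fun t : ℝ≥0 ↦ M t ω) ∧
        ∀ᵐ ω ∂preWienerMeasure, ∀ t : ℝ≥0,
          stoppedProcess (imaginaryHarmonicProcess κ ρ O W z)
            (fun ω ↦ Loewner.approachTime (fun s ↦ W s ω) z δ) t ω = M t ω

/-- **Discharge of `MillerSheffield2016_thm24_forward_ae`** (Miller–Sheffield 2016, Thm. 2.4 (⇒)
for the tree's SLE(κ, ρ)): `M = 𝔥_0(z) + (2λ/π) K` with the square-integrable martingale `K` of
`exists_martingale_stoppedProcess_imaginaryHarmonicProcess`. [cite: MillerSheffield2016, Thm. 2.4 (forward direction)] -/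
theorem MillerSheffield2016_thm24_forward_ae_holds : MillerSheffield2016_thm24_forward_ae := by
  intro κ ρ hκ hρ O W hOW z hz δ hδ
  haveI := isProbabilityMeasure_preWienerMeasure'
  obtain ⟨K, hKM, hKc, hae⟩ :=
    SLEKappaRho.exists_martingale_stoppedProcess_imaginaryHarmonicProcess hκ hρ hOW hz hδ
  set c₀ : ℝ := igLambda κ - ((2 + ρ) * igLambda κ / π) * arg z
  set c : ℝ := 2 * igLambda κ / π
  refine ⟨fun t ω ↦ c₀ + c * K t ω, ?_, ?_, hae⟩
  · have hM : Martingale (fun t ω ↦ c₀ + c * K t ω) brownianFiltration preWienerMeasure := by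
      have h1 := (martingale_const brownianFiltration preWienerMeasure c₀).add (hKM.smul c)
      exact h1
    exact hM.isLocalMartingale
  · filter_upwards [hKc] with ω hω
    exact continuous_const.add (continuous_const.mul hω)

/-- The statement of the original named fact implies the corrected one (take `M` to be the stopped
process itself): the correction only weakens "is" to "is indistinguishable from". [folklore] -/
theorem MillerSheffield2016_thm24_forward_ae_of (h : MillerSheffield2016_thm24_forward) :
    MillerSheffield2016_thm24_forward_ae := by
  intro κ ρ hκ hρ O W hOW z hz δ hδ
  obtain ⟨hM, hc⟩ := h κ ρ hκ hρ O W hOW z hz δ hδ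
  exact ⟨_, hM, hc, ae_of_all _ fun _ _ ↦ rfl⟩

end Literature.Probability.RandomPlanarGeometry
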